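import Summits.QuantumFields.GaugeBoot.OneOverNFreeEnergyPrep
import HarnessLib

/-!
# The `1/N` expansion of the free energy of strongly coupled `SO(N)` lattice gauge theory, to all orders (gauge-boot, ADDENDUM 30 part K)

HONEST FRAMING (cell `pub-gaugeboot`, page 1 of every file): the venture produces certified bounds
on lattice expectations at stated coupling, gauge group, dimension and torus size; NOT a mass gap,
NOT a continuum limit, NOT a string tension; NOT Yang–Mills-summit-bearing (barriers
`FixedCouplingUltralocality`, `PerturbativeInvisibility`).  Strong-coupling `SO(N)` lattice gauge theory with free boundary
condition (S. Chatterjee, Comm. Math. Phys. **366** (2019); S. Chatterjee, J. Jafarov, arXiv:1604.04777); nothing about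
four-dimensional continuum Yang–Mills or a mass gap.

## Content

★ `avg_uniform_estimate` — for any family `F` with the uniform finite-volume bounds of the `1/N` expansion, the bounds
`|f_k| ≤ C_k L_k^{|s|}` and plaquette independence, the plaquette average over the cube `Λ_N = [−M_N, M_N]^d` satisfies, UNIFORMLY
in the coupling `|t| ≤ β₀(d,k+1)`,
`| N^k ( |Λ_N|⁻¹ Σ_{q ∈ 𝒫(Λ_N)} φ_{Λ_N,N,t}((∂q)) − D Σ_{i<k} f_i(t,(∂p)) N^{−i} ) − D f_k(t,(∂p)) | ≤ ε_N → 0`, `D = d(d−1)/2`,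
as soon as `N^{k+1}/M_N → 0` (interior plaquettes by the uniform bound at order `k+1`; the boundary layer of depth
`4(k+1)(log₂N+3)` has density `O(log N/M_N)` and carries `O(N^k)`).
★★★ `freeEnergy_expansion_of` — consequently, with `log Z_{Λ,N,β} = N² ∫₀^β Σ_{q∈𝒫(Λ)} φ_{Λ,N,t}((∂q)) dt` (sibling
`LogPartitionFunction`): for `|β| ≤ β₀(d,k+1)` and cubes with `N^{k+1}/M_N → 0`,

  `N^k ( log Z_{Λ_N,N,β}/(N²|Λ_N|) − Σ_{i<k} N^{−i} D ∫₀^β f_i(t,(∂p)) dt ) ⟶ D ∫₀^β f_k(t,(∂p)) dt`,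

i.e. THE `1/N` EXPANSION OF THE FREE ENERGY PER SITE TO ALL ORDERS, `log Z/(N²|Λ|) = Σ_{i≤k} F_i(β) N^{−i} + o(N^{−k})` with
`F_i(β) = (d(d−1)/2) ∫₀^β f_i(t, (∂p)) dt` (order `0` is Chatterjee's Corollary 3.4, sibling `LimitingPartitionFunction`).  The statement is
not in the sources.  ★★★ `oneOverN_freeEnergy` packages it with the lane's coefficients `f_k = F_{k+2}` of `oneOverN_master`.

Everything is `[folklore]` given the siblings.
-/

noncomputable section

open Filter Topology MeasureTheory
open Literature.Probability.LatticeModels (Site box)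
open Literature.MathematicalPhysics.QuantumLattice (ZdEdge ZdPlaquette)
open Literature.MathematicalPhysics.QuantumFieldTheory (latticeNorm plaquettesIn)
open Literature.MathematicalPhysics.QuantumFieldTheory.Chatterjee2019LargeN
open Literature.MathematicalPhysics.QuantumFieldTheory.Chatterjee2019LargeN.CoeffCatalanBoundProof

namespace Summit.QuantumFields.GaugeBoot

namespace StringDuality

variable {d : ℕ}

/-- `|∂p| = 4` as a loop sequence length. [cite: Chatterjee2019LargeN, §2.1 (plaquettes have length four)] -/
theorem len_plaquetteWord_seq (q : ZdPlaquette d) : LoopSeq.len [plaquetteWord q] = 4 := rfl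

variable (d)

/-- ★ **The uniform plaquette-average estimate.**  See the module docstring.
[cite: ChatterjeeJafarov2016OneOverN, Theorem 3.1; Chatterjee2019LargeN, §15 (proof of Corollary 3.4)] -/
theorem avg_uniform_estimate {F : ℕ → ℝ → LoopSeq d → ℝ} {β₀ C L : ℕ → ℝ}
    (hanti : ∀ k, β₀ (k + 1) ≤ β₀ k) (hC : ∀ k, 0 ≤ C k) (hL : ∀ k, 1 ≤ L k)
    (hB : ∀ (k : ℕ) (β : ℝ), |β| ≤ β₀ k → ∀ s : LoopSeq d, IsLoopSeq s → |F (k + 2) β s| ≤ C k * L k ^ s.len)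
    (hQ : ∀ (k : ℕ) (β : ℝ), |β| ≤ β₀ k → ∀ (Λ : Finset (Site d)) (N : ℕ), 2 ≤ N → ∀ s : LoopSeq d, IsLoopSeq s →
      (∀ l ∈ s, ∀ e ∈ l, ∀ v : Site d,
        latticeNorm (v - DEdge.src e) ≤ ((k * (4 * (Nat.log 2 N + 3)) : ℕ) : ℝ) ∨
          latticeNorm (v - DEdge.tgt e) ≤ ((k * (4 * (Nat.log 2 N + 3)) : ℕ) : ℝ) → v ∈ Λ) →
      |(N : ℝ) ^ k * (phi N β Λ s - ∑ i ∈ Finset.range k, F (i + 2) β s / (N : ℝ) ^ i)| ≤ C k * L k ^ s.len)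
    (hPI : ∀ (k : ℕ) (β : ℝ), |β| ≤ β₀ (k + 1) → ∀ p q : ZdPlaquette d,
      F (k + 2) β [plaquetteWord p] = F (k + 2) β [plaquetteWord q])
    (k : ℕ) (p : ZdPlaquette d) {M : ℕ → ℕ} (hM' : Tendsto M atTop atTop)
    (hM : Tendsto (fun N : ℕ => (N : ℝ) ^ (k + 1) / (M N : ℝ)) atTop (𝓝 0)) :
    ∃ ε : ℕ → ℝ, Tendsto ε atTop (𝓝 0) ∧ ∀ᶠ N : ℕ in atTop, ∀ t : ℝ, |t| ≤ β₀ (k + 1) →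
      |(N : ℝ) ^ k * ((∑ q ∈ plaquettesIn (box d (M N)),
          (if h : q.2.1 < q.2.2 then phi N t (box d (M N)) [plaquetteWord ⟨q.1, ⟨(q.2.1, q.2.2), h⟩⟩] else 0)) /
            (box d (M N)).card
          - (d : ℝ) * ((d : ℝ) - 1) / 2 * ∑ i ∈ Finset.range k, F (i + 2) t [plaquetteWord p] / (N : ℝ) ^ i)
        - (d : ℝ) * ((d : ℝ) - 1) / 2 * F (k + 2) t [plaquetteWord p]| ≤ ε N := by
  -- constants
  set D : ℝ := (d : ℝ) * ((d : ℝ) - 1) / 2 with hDdef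
  have hD0 : 0 ≤ D := by rw [hDdef, ← card_pairsLT_real]; positivity
  set A : ℝ := ∑ i ∈ Finset.range k, C i * L i ^ 4 with hAdef
  have hA0 : 0 ≤ A := Finset.sum_nonneg fun i _ => by have := hC i; have := hL i; positivity
  set Bk : ℝ := C k * L k ^ 4 with hBk
  have hBk0 : 0 ≤ Bk := by have := hC k; have := hL k; positivity
  set Cq : ℝ := C (k + 1) * L (k + 1) ^ 4 with hCq
  have hCq0 : 0 ≤ Cq := by have := hC (k + 1); have := hL (k + 1); positivity
  clear_value D A Bk Cq
  set R : ℕ → ℕ := fun N => (k + 1) * (4 * (Nat.log 2 N + 3)) with hR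
  refine ⟨fun N => D * Cq / N + D * d * (1 + A + Bk) * ((N : ℝ) ^ (k + 1) / (M N : ℝ)), ?_, ?_⟩
  · -- `ε_N → 0`
    have h1 : Tendsto (fun N : ℕ => D * Cq / (N : ℝ)) atTop (𝓝 0) := by
      simpa [mul_div_assoc] using (tendsto_const_div_atTop_nhds_zero_nat (D * Cq))
    have h2 := hM.const_mul (D * d * (1 + A + Bk))
    rw [mul_zero] at h2
    simpa using h1.add h2
  -- eventual conditions on `N`
  have e1 : ∀ᶠ N : ℕ in atTop, 2 ≤ N := eventually_ge_atTop 2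
  have e2 : ∀ᶠ N : ℕ in atTop, 1 ≤ M N := (tendsto_atTop.mp hM') 1
  have e3 : ∀ᶠ N : ℕ in atTop, (N : ℝ) ^ (k + 1) / (M N : ℝ) < 1 := hM.eventually (gt_mem_nhds one_pos)
  have e4 : ∀ᶠ N : ℕ in atTop, R N + 1 ≤ N := adm_of_superlog superlog_linear (k + 1) 1
  filter_upwards [e1, e2, e3, e4] with N hN2 hM1 hlt hRN t ht
  have hN0 : (0 : ℝ) < N := by exact_mod_cast (by omega : 0 < N)
  have hN1 : (1 : ℝ) ≤ N := by exact_mod_cast (by omega : 1 ≤ N)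
  have hMpos : (0 : ℝ) < (M N : ℝ) := by exact_mod_cast hM1
  -- `R_N + 1 ≤ M_N`
  have hpowN : (N : ℝ) ≤ (N : ℝ) ^ (k + 1) := le_self_pow₀ hN1 (by omega)
  have hMR : R N + 1 ≤ M N := by
    have h1 : (N : ℝ) ^ (k + 1) < M N := by rwa [div_lt_one hMpos] at hlt
    have h2 : ((R N + 1 : ℕ) : ℝ) ≤ N := by exact_mod_cast hRN
    have h3 : ((R N + 1 : ℕ) : ℝ) < M N := lt_of_le_of_lt (h2.trans hpowN) h1
    exact_mod_cast h3.le
  -- thresholds at the lower orders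
  have hti : ∀ i, i ≤ k + 1 → |t| ≤ β₀ i := fun i hi => ht.trans (antitone_of_succ_le hanti hi)
  -- notation for this `N`
  set Λ := box d (M N) with hΛ
  set P := plaquettesIn Λ with hP
  set I := box d (M N - (R N + 1)) ×ˢ (Finset.univ.filter fun q : Fin d × Fin d => q.1 < q.2) with hI
  have hIP : I ⊆ P := by rw [hI, hP, hΛ]; exact box_product_subset_plaquettesIn hMR
  have hb : (0 : ℝ) < Λ.card := by exact_mod_cast card_box_pos (M N)
  set ρ : ℝ := ((box d (M N - (R N + 1))).card : ℝ) / Λ.card with hρ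
  have hIcard : (I.card : ℝ) = D * (Λ.card * ρ) := by
    rw [hI, Finset.card_product, Nat.cast_mul, card_pairsLT_real, ← hDdef, hρ]
    field_simp
  have hPcard : (P.card : ℝ) ≤ Λ.card * D := by rw [hDdef]; exact card_plaquettesIn_le Λ
  have h1ρ : 1 - ρ ≤ (d : ℝ) * ((R N : ℝ) + 1) / (M N : ℝ) := one_sub_box_ratio_le hMR
  have hρ1 : ρ ≤ 1 := by
    rw [hρ, div_le_one hb]
    exact_mod_cast Finset.card_le_card (fun y hy => by
      rw [mem_box_iff] at hy ⊢
      intro i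
      have := hy i
      have hc : ((M N - (R N + 1) : ℕ) : ℤ) ≤ M N := by exact_mod_cast Nat.sub_le (M N) (R N + 1)
      constructor <;> linarith [this.1, this.2])
  have hΛne : Λ.Nonempty := Finset.card_pos.mp (card_box_pos (M N))
  clear_value ρ
  -- the summand and the reference quantities
  set FN : Site d × Fin d × Fin d → ℝ := fun q =>
    if h : q.2.1 < q.2.2 then phi N t Λ [plaquetteWord ⟨q.1, ⟨(q.2.1, q.2.2), h⟩⟩] else 0 with hFN
  set S : ℝ := ∑ i ∈ Finset.range k, F (i + 2) t [plaquetteWord p] / (N : ℝ) ^ i with hS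
  set fk : ℝ := F (k + 2) t [plaquetteWord p] with hfk
  have hFN1 : ∀ q, |FN q| ≤ 1 := by
    intro q; simp only [hFN]; split_ifs
    · exact abs_phi_le_one _ _ _ _
    · simp
  have hSA : |S| ≤ A := by
    rw [hS, hAdef]
    refine (Finset.abs_sum_le_sum_abs _ _).trans (Finset.sum_le_sum fun i hi => ?_)
    have hik : i ≤ k + 1 := (Finset.mem_range.mp hi).le.trans (Nat.le_succ k)
    rw [abs_div, abs_of_pos (pow_pos hN0 i)]
    refine (div_le_self (abs_nonneg _) (one_le_pow₀ hN1)).trans ?_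
    simpa [len_plaquetteWord_seq] using hB i t (hti i (by omega)) _ (isLoopSeq_plaquette p)
  have hfkB : |fk| ≤ Bk := by
    simpa [hfk, hBk, len_plaquetteWord_seq] using hB k t (hti k (Nat.le_succ k)) _ (isLoopSeq_plaquette p)
  -- interior plaquettes: the uniform bound at order `k + 1`
  have hint : ∀ q ∈ I, |(N : ℝ) ^ k * (FN q - S) - fk| ≤ Cq / N := by
    rintro ⟨x, i, j⟩ hq
    rw [hI, Finset.mem_product, Finset.mem_filter] at hq
    obtain ⟨hx, -, hij⟩ := hq
    simp only [hFN, dif_pos hij]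
    set q' : ZdPlaquette d := ⟨x, ⟨(i, j), hij⟩⟩
    have h := hQ (k + 1) t ht Λ N hN2 [plaquetteWord q'] (isLoopSeq_plaquette _) (ball_plaquetteWord_box hMR hx _)
    rw [len_plaquetteWord_seq, ← hCq] at h
    have hsum : ∑ n ∈ Finset.range (k + 1), F (n + 2) t [plaquetteWord q'] / (N : ℝ) ^ n = S + fk / (N : ℝ) ^ k := by
      rw [Finset.sum_range_succ, hS, hfk, hPI k t ht q' p,
        Finset.sum_congr rfl (fun n hn => by rw [hPI n t (hti (n + 1) (by have := Finset.mem_range.mp hn; omega)) q' p])]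
    rw [hsum] at h
    have hid : (N : ℝ) ^ (k + 1) * (phi N t Λ [plaquetteWord q'] - (S + fk / (N : ℝ) ^ k)) =
        (N : ℝ) * ((N : ℝ) ^ k * (phi N t Λ [plaquetteWord q'] - S) - fk) := by
      rw [pow_succ]; field_simp; ring
    rw [hid, abs_mul, abs_of_pos hN0] at h
    rw [le_div_iff₀ hN0, mul_comm]; exact h
  -- the decomposition of the target
  set SI : ℝ := ∑ q ∈ I, FN q with hSI
  set SB : ℝ := ∑ q ∈ P \ I, FN q with hSB
  have hsplit : ∑ q ∈ P, FN q = SI + SB := by rw [hSI, hSB, ← Finset.sum_sdiff hIP, add_comm]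
  set SI' : ℝ := ∑ q ∈ I, ((N : ℝ) ^ k * (FN q - S) - fk) with hSI'
  have hSI'eq : SI' = (N : ℝ) ^ k * SI - I.card * ((N : ℝ) ^ k * S + fk) := by
    rw [hSI', hSI, Finset.sum_sub_distrib, Finset.sum_const, nsmul_eq_mul, ← Finset.mul_sum, Finset.sum_sub_distrib,
      Finset.sum_const, nsmul_eq_mul]
    ring
  have hT : (N : ℝ) ^ k * ((∑ q ∈ P, FN q) / Λ.card - D * S) - D * fk =
      SI' / Λ.card + (N : ℝ) ^ k * SB / Λ.card + ((I.card : ℝ) / Λ.card - D) * ((N : ℝ) ^ k * S + fk) := by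
    rw [hsplit, hSI'eq]
    field_simp
    ring
  -- the three bounds
  have hb1 : |SI' / Λ.card| ≤ D * (Cq / N) := by
    rw [abs_div, abs_of_pos hb, div_le_iff₀ hb]
    calc |SI'| ≤ ∑ q ∈ I, |(N : ℝ) ^ k * (FN q - S) - fk| := Finset.abs_sum_le_sum_abs _ _
      _ ≤ ∑ _q ∈ I, Cq / N := Finset.sum_le_sum hint
      _ = I.card * (Cq / N) := by rw [Finset.sum_const, nsmul_eq_mul]
      _ = D * (Cq / N) * (Λ.card * ρ) := by rw [hIcard]; ring
      _ ≤ D * (Cq / N) * (Λ.card * 1) := by gcongr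
      _ = D * (Cq / N) * Λ.card := by rw [mul_one]
  have hb2 : |(N : ℝ) ^ k * SB / Λ.card| ≤ (N : ℝ) ^ k * (D * (1 - ρ)) := by
    rw [abs_div, abs_of_pos hb, div_le_iff₀ hb, abs_mul, abs_of_pos (pow_pos hN0 k)]
    have hSB' : |SB| ≤ (P \ I).card := by
      calc |SB| ≤ ∑ q ∈ P \ I, |FN q| := Finset.abs_sum_le_sum_abs _ _
        _ ≤ ∑ _q ∈ P \ I, (1 : ℝ) := Finset.sum_le_sum fun q _ => hFN1 q
        _ = ((P \ I).card : ℝ) := by rw [Finset.sum_const, nsmul_eq_mul, mul_one]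
    have hcard : ((P \ I).card : ℝ) ≤ D * (1 - ρ) * Λ.card := by
      rw [Finset.card_sdiff_of_subset hIP, Nat.cast_sub (Finset.card_le_card hIP), hIcard]
      nlinarith
    calc (N : ℝ) ^ k * |SB| ≤ (N : ℝ) ^ k * (D * (1 - ρ) * Λ.card) :=
          mul_le_mul_of_nonneg_left (hSB'.trans hcard) (pow_nonneg hN0.le k)
      _ = (N : ℝ) ^ k * (D * (1 - ρ)) * Λ.card := by ring
  have hb3 : |((I.card : ℝ) / Λ.card - D) * ((N : ℝ) ^ k * S + fk)| ≤ D * (1 - ρ) * ((N : ℝ) ^ k * (A + Bk)) := by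
    have hcoef : (I.card : ℝ) / Λ.card - D = -(D * (1 - ρ)) := by rw [hIcard]; field_simp; ring
    rw [hcoef, abs_mul, abs_neg, abs_of_nonneg (mul_nonneg hD0 (by linarith))]
    refine mul_le_mul_of_nonneg_left ?_ (mul_nonneg hD0 (by linarith))
    have hNk1 : (1 : ℝ) ≤ (N : ℝ) ^ k := one_le_pow₀ hN1
    calc |(N : ℝ) ^ k * S + fk| ≤ |(N : ℝ) ^ k * S| + |fk| := abs_add_le _ _
      _ ≤ (N : ℝ) ^ k * A + (N : ℝ) ^ k * Bk := by
          rw [abs_mul, abs_of_pos (pow_pos hN0 k)]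
          exact add_le_add (mul_le_mul_of_nonneg_left hSA (pow_nonneg hN0.le k))
            (hfkB.trans (le_mul_of_one_le_left hBk0 hNk1))
      _ = (N : ℝ) ^ k * (A + Bk) := by ring
  -- `(1 − ρ) N^k ≤ d N^{k+1}/M_N`
  have h1ρN : (1 - ρ) * (N : ℝ) ^ k ≤ (d : ℝ) * ((N : ℝ) ^ (k + 1) / (M N : ℝ)) := by
    have hR1 : ((R N : ℝ) + 1) * (N : ℝ) ^ k ≤ (N : ℝ) ^ (k + 1) := by
      have : ((R N : ℝ) + 1) ≤ N := by exact_mod_cast hRN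
      rw [pow_succ, mul_comm ((N : ℝ) ^ k)]
      exact mul_le_mul_of_nonneg_right this (pow_nonneg hN0.le k)
    calc (1 - ρ) * (N : ℝ) ^ k ≤ (d : ℝ) * ((R N : ℝ) + 1) / (M N : ℝ) * (N : ℝ) ^ k :=
          mul_le_mul_of_nonneg_right h1ρ (pow_nonneg hN0.le k)
      _ = (d : ℝ) * ((((R N : ℝ) + 1) * (N : ℝ) ^ k) / (M N : ℝ)) := by ring
      _ ≤ (d : ℝ) * ((N : ℝ) ^ (k + 1) / (M N : ℝ)) := by gcongr
  -- assemble
  show |(N : ℝ) ^ k * ((∑ q ∈ P, FN q) / (Λ.card : ℝ) - D * S) - D * fk| ≤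
    D * Cq / N + D * d * (1 + A + Bk) * ((N : ℝ) ^ (k + 1) / (M N : ℝ))
  rw [hT]
  have hDAB : 0 ≤ D * (1 + A + Bk) := mul_nonneg hD0 (by linarith)
  set X1 : ℝ := SI' / Λ.card with hX1
  set X2 : ℝ := (N : ℝ) ^ k * SB / Λ.card with hX2
  set X3 : ℝ := ((I.card : ℝ) / Λ.card - D) * ((N : ℝ) ^ k * S + fk) with hX3
  clear_value X1 X2 X3 S fk SI SB SI' FN
  calc |X1 + X2 + X3| ≤ |X1| + |X2| + |X3| := abs_add_three X1 X2 X3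
    _ ≤ D * (Cq / N) + (N : ℝ) ^ k * (D * (1 - ρ)) + D * (1 - ρ) * ((N : ℝ) ^ k * (A + Bk)) :=
        add_le_add (add_le_add hb1 hb2) hb3
    _ = D * Cq / N + D * (1 + A + Bk) * ((1 - ρ) * (N : ℝ) ^ k) := by ring
    _ ≤ D * Cq / N + D * (1 + A + Bk) * ((d : ℝ) * ((N : ℝ) ^ (k + 1) / (M N : ℝ))) :=
        add_le_add le_rfl (mul_le_mul_of_nonneg_left h1ρN hDAB)
    _ = D * Cq / N + D * d * (1 + A + Bk) * ((N : ℝ) ^ (k + 1) / (M N : ℝ)) := by ring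

end StringDuality

end Summit.QuantumFields.GaugeBoot

end
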